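/-
Copyright (c) 2026 the pub-hodgecm-mathlib formalisation cell (harness21).  Prover seat hodgecm-mathlib-K2Liu-p03 (g7): Track B «K2-LIT», hLiu418 = stmt-HodgeConjecture-24832,
socket #41, the I4 block (middle-cell term package `E₇`), brick (D1) «THE CORNER-LINE MAJORANT» (LEAD F0P6-plan (g14) BATCH #82 (1); I4 desk K2E4-p11 (g8)).
-/
import Summits.HodgeConjecture.HodgeConjecture.Theorems.K2LiuStdExtensionDatumMonotone                  -- ★ `stdExtension_apply_eq_of_flat` (a standard family is flat over its `s₀`-value)
import Summits.HodgeConjecture.HodgeConjecture.Theorems.K2LiuIwasawaHeightContinuous                     -- ★ `continuous_iwasawaHeight`, `iwasawaHeight_delta_mul`, `iwasawaHeight_of_mem_K`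
import Summits.HodgeConjecture.HodgeConjecture.Theorems.K2LiuSiegelEisensteinDoubledSummableReduction    -- ★ `norm_siegelDeltaCharacter`
import Summits.HodgeConjecture.HodgeConjecture.Theorems.K2LiuMiddleInnerSectionHolomorphic               -- ★ (β0-hol) `differentiableOn_unfolded` (dominated holomorphy, majorant BY VALUE)
import Summits.HodgeConjecture.HodgeConjecture.Theorems.K2LiuUnipDeltaCornerUnfoldC                      -- ★ C-part `inner_section_unfold` (the corner line `n₂`, the transfer and the unfolding)
import HarnessLib

/-!
# Crux `HLiu418`, socket #41, I4 block, (D1) THE CORNER-LINE MAJORANT: the two (β0-hol) analytic letters `hint` ∕ `hFhol` of ★ I4 ED. 4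
# `exists_middleTerm_package_of_standard` FROM ONE REAL LETTER — the integrability of the Iwasawa height along the corner line

Cell `hodgecm-mathlib`, crux item hLiu418 = `stmt-HodgeConjecture-24832`; squad K2 ∕ K2Liu; prover K2Liu-p03 (g7) (LEAD F0P6-plan (g14) BATCH #82 (1); I4 desk K2E4-p11 (g8)).
THEOREMS ONLY (no `def`, no instance, no notation, no named-fact hypothesis, no `sorry`); lane `--supports stmt-HodgeConjecture-24832 --as helper`.

WHY.  ★ I4 ED. 4 (`K2LiuSiegelEisensteinMiddleTermOfStandard.exists_middleTerm_package_of_standard`, K2E4-p11) takes BY VALUE, for the inner section of the middle cell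
`F_s(y) = ∫ β₁(u) • f_s(w₀·(u·y)) dνN(u)` of a STANDARD family `f`, the two analytic letters
  `hint : ∀ s, 0 < re s → ∀ k ∈ 𝒦.K, Integrable (u ↦ β₁ u • f_s(w₀ (u k))) νN`,  `hFhol : ∀ y, DifferentiableOn ℂ (s ↦ F_s y) {0 < re}`.
By ★ C-part `inner_section_unfold` both live on the corner line `n₂ : 𝔸_{L⁺} → N_Δ(𝔸)` (`∫ β₁ • f(w₀(u y)) dνN = C • ∫ f(w₀ n₂(t) y) dμ(t)`, integrability transfers), and by ★ (β0-hol)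
`differentiableOn_unfolded` holomorphy follows from a locally-uniform integrable MAJORANT on that line.  THIS FILE reduces both letters to ONE real-valued letter — the
integrability of the Iwasawa height `H_𝒦 = modΔ ∘ pPart` along the corner line,
  `hJ : ∀ σ > 0, Integrable (t ↦ H_𝒦(w₀ · n₂ t)^{2σ + n}) μ`
(locally `H_𝒦(w₀ n₂(t))² = ∏_v max(1, |t|_v)^{−2}`: a RANK-ONE intertwining integrand, convergent exactly for `σ > 0` — brick (D1) FILE 2) — via two elementary bounds:
* §1 **`exists_norm_le_height_rpow_of_standard`** — a STANDARD family with continuous members and a UNITARY `χ` is dominated by its height, UNIFORMLY IN `s`: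
  `‖f_s(h)‖ ≤ C₀ · H_𝒦(h)^{2 re s + n}` (flatness ★ `stdExtension_apply_eq_of_flat` at `s₀ = 0`, the Siegel law at `pPart h`, ★ `norm_siegelDeltaCharacter`, `C₀ = sup_K ‖f₀‖`);
* §2 **`exists_height_mul_le`** — right translation distorts the height boundedly: `H_𝒦(g·y) ≤ C_y · H_𝒦(g)`, `C_y = max(1, sup_{k∈K} H_𝒦(k·y))` (`H_𝒦(g y) = H_𝒦(g)·H_𝒦(k_g y)`);
* §3 **`integrable_corner_of_height`** — `hJ ⇒ ∀ s, 0 < re s → ∀ y, Integrable (t ↦ f_s(w₀·(n₂ t·y))) μ` (ANY measure space `T`, ANY continuous `n₂`, ANY `w₀`);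
* §4 **`differentiableOn_corner_of_height`** — `hJ ⇒ ∀ y c, DifferentiableOn ℂ (s ↦ c · ∫ f_s(w₀ · n₂ t · y) dμ) {0 < re}` (the majorant on `ball z (re z ∕ 2)` is
  `C₀·C_y^{a₂}·(H^{a₁} + H^{a₂})`, `aᵢ = 2σᵢ + n`, `σ₁ = re z∕2`, `σ₂ = 3 re z∕2` — no boundedness of `H` is used: `x^a ≤ x^{a₁} + x^{a₂}` for `a₁ ≤ a ≤ a₂`, `x > 0`, inlined);
* §5 **`hint_and_hFhol_of_cornerHeight`** — AT THE DATUM OF #41 (`n = 2`, `w₀ = ι(1, g₀)`, ★ α3-2's letters `hg₀ Λ hΛ Γ₀ hΓ₀` VERBATIM): the two I4 letters BYTE FOR BYTE from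
  `hJ` quantified over the corner lines of ★ C-part (any `n₂` with its membership and block clauses, any additive Haar measure of `𝔸_{L⁺}`) — the Haar measure and
  `n₂` are built inside exactly as in ★ I4 ED. 4 §2 `innerFamily_laws`.
[MoeglinWaldspurger1995, II.1.6–II.1.7, IV.1.9]; [KudlaRallis1994, §2 (2.10)–(2.12)]; [Tan1999, §1, §4 Prop. 4.8]; [Garrett2018, §3.10]; [Conway1978, IV §2].
HONEST LABEL.  Count-neutral helper: `HC_CM` is proved only modulo the 7 printed citations (2 remaining named inputs: hLiu418 = `stmt-HodgeConjecture-24832`,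
h413 = `stmt-HodgeConjecture-24833`) until rung 0 closes.  NOT here: the corner-line height integral `hJ` itself ((D1) FILE 2 `K2LiuCornerLineHeightIntegrable`).
-/

set_option autoImplicit false
set_option linter.dupNamespace false -- the mandated namespace repeats `HodgeConjecture.HodgeConjecture`

noncomputable section

open scoped Matrix ENNReal NNReal
open NumberField IsDedekindDomain MeasureTheory MeasureTheory.Measure Filter Set Topology Metric
open Literature.NumberTheory.Automorphic Literature.NumberTheory.Automorphic.UnitaryGroup Literature.NumberTheory.GaloisRepresentations
open Literature.NumberTheory.GelbartRogawski1991 Literature.NumberTheory.GelbartRogawski1991.GRConstruction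
open Literature.NumberTheory.GelbartRogawski1991.AdaptedBlocks
open Literature.NumberTheory.K2Lit.SiegelDoubled Literature.MeasureTheory.Group
open UnitaryDualPair
open Summit.HodgeConjecture.HodgeConjecture.Cruxes.HLiu418.K2LiuStdExtensionDatumMonotone (stdExtension_apply_eq_of_flat)
open Summit.HodgeConjecture.HodgeConjecture.Cruxes.HLiu418.K2LiuIwasawaHeightContinuous (continuous_iwasawaHeight iwasawaHeight_delta_mul iwasawaHeight_of_mem_K)
open Summit.HodgeConjecture.HodgeConjecture.Cruxes.HLiu418.K2LiuSiegelEisensteinDoubledSummableReduction (norm_siegelDeltaCharacter)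
open Summit.HodgeConjecture.HodgeConjecture.Cruxes.HLiu418.K2LiuMiddleInnerSectionHolomorphic (differentiableOn_unfolded)
open Summit.HodgeConjecture.HodgeConjecture.Cruxes.HLiu418.K2LiuUnipDeltaCornerUnfoldC (inner_section_unfold)

namespace Summit.HodgeConjecture.HodgeConjecture.Cruxes.HLiu418.K2LiuSiegelMiddleTermCornerMajorant

variable (L : Type) [Field L] [NumberField L] [IsCMField L]
variable {N M n : ℕ} (e : Fin N × Fin M ≃ Fin n)
  (dV : Fin N → L) (hdV : ∀ i, IsCMField.complexConj L (dV i) = dV i) (hdV0 : ∀ i, dV i ≠ 0)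
  (dW : Fin M → L) (hdW : ∀ i, IsCMField.complexConj L (dW i) = dW i) (hdW0 : ∀ i, dW i ≠ 0)

/-! ## §0 A real-power inequality (`x^a ≤ x^{a₁} + x^{a₂}` for `a₁ ≤ a ≤ a₂` is ★ `K2E1PseudoEisensteinContourShiftCMTwo.rpow_le_rpow_add_rpow`; inlined in §4 to keep the imports light) -/

/-- `(C·x)^a ≤ C^{a₂}·x^a` for `C ≥ 1`, `x ≥ 0`, `a ≤ a₂`. [folklore] -/
theorem mul_rpow_le_rpow_mul_rpow {C x a a₂ : ℝ} (hC : 1 ≤ C) (hx : 0 ≤ x) (h₂ : a ≤ a₂) : (C * x) ^ a ≤ C ^ a₂ * x ^ a := by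
  rw [Real.mul_rpow (zero_le_one.trans hC) hx]
  exact mul_le_mul_of_nonneg_right (Real.rpow_le_rpow_of_exponent_le hC h₂) (Real.rpow_nonneg hx _)

/-! ## §1 A standard family is dominated by its height, uniformly in `s` -/

/-- **`‖f_s(h)‖ ≤ C₀ · H_𝒦(h)^{2 re s + n}` FOR A STANDARD FAMILY** (`χ` unitary, continuous members): `f_s = H_𝒦^{2s}·f₀` on the nose (flatness, ★
`stdExtension_apply_eq_of_flat` at `s₀ = 0`), `f₀(h) = σ_{χ,0}(pPart h)·f₀(kPart h)` (Siegel law) with `‖σ_{χ,0}(p)‖ = modΔ(p)^n` (★ `norm_siegelDeltaCharacter`) and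
`‖f₀‖ ≤ C₀` on the compact `K`. [cite: KudlaRallis1994, §1] [cite: Tan1999, §1 p. 166] [cite: MoeglinWaldspurger1995, II.1.6] -/
theorem exists_norm_le_height_rpow_of_standard (𝒦 : IwasawaDatum L e dV hdV dW hdW) {χ : HeckeCharacter L} (hχ : χ.IsUnitary)
    {f : ℂ → HA L e dV hdV dW hdW → ℂ} (hf : IsStandardSectionFamily 𝒦 χ f) (hcont : ∀ s : ℂ, Continuous (f s)) :
    ∃ C₀ : ℝ, 0 ≤ C₀ ∧ ∀ (s : ℂ) (h : HA L e dV hdV dW hdW),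
      ‖f s h‖ ≤ C₀ * modDelta L e dV hdV dW hdW (𝒦.pPart h) ^ (2 * s.re + (n : ℝ)) := by
  obtain ⟨C₀, hC₀⟩ := 𝒦.isCompact_K.exists_bound_of_continuousOn (hcont 0).continuousOn
  refine ⟨max C₀ 0, le_max_right _ _, fun s h => ?_⟩
  have hM := modDelta_pos L e dV hdV dW hdW (𝒦.pPart h)
  have hflat := stdExtension_apply_eq_of_flat (𝒦 := 𝒦) hf.1.1 hf.2.2 0 s h
  have h0 : f 0 h = siegelDeltaCharacter L e dV hdV dW hdW χ 0 (𝒦.pPart h) * f 0 (𝒦.kPart h) := by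
    conv_lhs => rw [← 𝒦.pPart_mul_kPart h]
    exact hf.1.1 0 _ (𝒦.pPart_isSiegelDelta h) (𝒦.kPart h)
  have hre : (2 * (s - 0) : ℂ).re = 2 * s.re := by simp [Complex.mul_re]
  rw [← hflat, stdExtension, h0, norm_mul, norm_mul, norm_siegelDeltaCharacter L e dV hdV dW hdW hχ 0 (𝒦.pPart h),
    Complex.norm_cpow_eq_rpow_re_of_pos hM, hre, Complex.zero_re, mul_zero, zero_add, ← mul_assoc, ← Real.rpow_add hM]
  have hk : ‖f 0 (𝒦.kPart h)‖ ≤ max C₀ 0 := (hC₀ _ (𝒦.kPart_mem h)).trans (le_max_left _ _)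
  calc modDelta L e dV hdV dW hdW (𝒦.pPart h) ^ (2 * s.re + (n : ℝ)) * ‖f 0 (𝒦.kPart h)‖
      ≤ modDelta L e dV hdV dW hdW (𝒦.pPart h) ^ (2 * s.re + (n : ℝ)) * max C₀ 0 := mul_le_mul_of_nonneg_left hk (Real.rpow_nonneg hM.le _)
    _ = max C₀ 0 * modDelta L e dV hdV dW hdW (𝒦.pPart h) ^ (2 * s.re + (n : ℝ)) := mul_comm _ _

/-! ## §2 Right translation distorts the height boundedly -/

include hdV0 hdW0 in
/-- **`H_𝒦(g·y) ≤ C_y · H_𝒦(g)` with `C_y ≥ 1`** (`g = p_g k_g`: `H_𝒦(g y) = modΔ(p_g)·H_𝒦(k_g y) = H_𝒦(g)·H_𝒦(k_g y)`, and `H_𝒦(· y)` is bounded on the compact `K` — ★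
`continuous_iwasawaHeight`). [cite: Garrett2018, §3.10] [cite: MoeglinWaldspurger1995, I.2.2] -/
theorem exists_height_mul_le (𝒦 : IwasawaDatum L e dV hdV dW hdW) (y : HA L e dV hdV dW hdW) :
    ∃ C : ℝ, 1 ≤ C ∧ ∀ g : HA L e dV hdV dW hdW,
      modDelta L e dV hdV dW hdW (𝒦.pPart (g * y)) ≤ C * modDelta L e dV hdV dW hdW (𝒦.pPart g) := by
  obtain ⟨C, hC⟩ := 𝒦.isCompact_K.exists_bound_of_continuousOn
    (((continuous_iwasawaHeight L e dV hdV hdV0 dW hdW hdW0 𝒦).comp (continuous_id.mul continuous_const : Continuous fun g : HA L e dV hdV dW hdW => g * y)).continuousOn)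
  refine ⟨max C 1, le_max_right _ _, fun g => ?_⟩
  have hg : g * y = 𝒦.pPart g * (𝒦.kPart g * y) := by rw [← mul_assoc, 𝒦.pPart_mul_kPart]
  have hk : modDelta L e dV hdV dW hdW (𝒦.pPart (𝒦.kPart g * y)) ≤ max C 1 := by
    have h1 := hC _ (𝒦.kPart_mem g)
    rw [Function.comp_apply, Real.norm_of_nonneg (modDelta_pos L e dV hdV dW hdW _).le] at h1
    exact h1.trans (le_max_left _ _)
  have hpg : modDelta L e dV hdV dW hdW (𝒦.pPart g) = modDelta L e dV hdV dW hdW (𝒦.pPart g) * modDelta L e dV hdV dW hdW (𝒦.pPart (𝒦.kPart g)) := by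
    conv_lhs => rw [← 𝒦.pPart_mul_kPart g]
    exact iwasawaHeight_delta_mul L e dV hdV hdV0 dW hdW hdW0 𝒦 (𝒦.pPart_isSiegelDelta g) _
  rw [iwasawaHeight_of_mem_K L e dV hdV hdV0 dW hdW hdW0 𝒦 (𝒦.kPart_mem g), mul_one] at hpg
  rw [hg, iwasawaHeight_delta_mul L e dV hdV hdV0 dW hdW hdW0 𝒦 (𝒦.pPart_isSiegelDelta g), mul_comm (max C 1)]
  exact mul_le_mul_of_nonneg_left hk (modDelta_pos L e dV hdV dW hdW _).le

/-! ## §3 Integrability along the corner line from the height letter -/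

include hdV0 hdW0 in
/-- **`hJ ⇒` the section family is integrable along the corner line on `{0 < re s}`**: for ANY measure space `T`, any continuous `n₂ : T → H(𝔸)`, any `w₀, y ∈ H(𝔸)`:
`Integrable (t ↦ f_s(w₀·(n₂ t·y))) μ` whenever `t ↦ H_𝒦(w₀·n₂ t)^{2σ+n}` is `μ`-integrable at `σ = re s > 0` (§1 + §2, `Integrable.mono'`).
[cite: MoeglinWaldspurger1995, II.1.6–II.1.7] [cite: KudlaRallis1994, §2 (2.10)–(2.12)] -/
theorem integrable_corner_of_height (𝒦 : IwasawaDatum L e dV hdV dW hdW) {χ : HeckeCharacter L} (hχ : χ.IsUnitary)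
    {f : ℂ → HA L e dV hdV dW hdW → ℂ} (hf : IsStandardSectionFamily 𝒦 χ f) (hcont : ∀ s : ℂ, Continuous (f s))
    {T : Type*} [MeasurableSpace T] [TopologicalSpace T] [OpensMeasurableSpace T] (μ : Measure T)
    (w₀ : HA L e dV hdV dW hdW) (n₂ : T → HA L e dV hdV dW hdW) (hn₂ : Continuous n₂) {σ : ℝ}
    (hJ : Integrable (fun t => modDelta L e dV hdV dW hdW (𝒦.pPart (w₀ * n₂ t)) ^ (2 * σ + (n : ℝ))) μ)
    (y : HA L e dV hdV dW hdW) {s : ℂ} (hs : 0 < s.re) (hsσ : s.re = σ) :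
    Integrable (fun t => f s (w₀ * (n₂ t * y))) μ := by
  subst hsσ
  obtain ⟨C₀, hC₀, hbd⟩ := exists_norm_le_height_rpow_of_standard L e dV hdV dW hdW 𝒦 hχ hf hcont
  obtain ⟨Cy, hCy, hy⟩ := exists_height_mul_le L e dV hdV hdV0 dW hdW hdW0 𝒦 y
  have ha : 0 ≤ 2 * s.re + (n : ℝ) := by positivity
  refine Integrable.mono' (hJ.const_mul (C₀ * Cy ^ (2 * s.re + (n : ℝ))))
    (((hcont s).comp (continuous_const.mul ((hn₂.mul continuous_const)))).aestronglyMeasurable) (Eventually.of_forall fun t => ?_)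
  have hM := modDelta_pos L e dV hdV dW hdW (𝒦.pPart (w₀ * n₂ t))
  calc ‖f s (w₀ * (n₂ t * y))‖
      ≤ C₀ * modDelta L e dV hdV dW hdW (𝒦.pPart (w₀ * (n₂ t * y))) ^ (2 * s.re + (n : ℝ)) := hbd s _
    _ ≤ C₀ * (Cy * modDelta L e dV hdV dW hdW (𝒦.pPart (w₀ * n₂ t))) ^ (2 * s.re + (n : ℝ)) := by
        refine mul_le_mul_of_nonneg_left (Real.rpow_le_rpow (modDelta_pos L e dV hdV dW hdW _).le ?_ ha) hC₀
        rw [← mul_assoc]; exact hy _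
    _ ≤ C₀ * (Cy ^ (2 * s.re + (n : ℝ)) * modDelta L e dV hdV dW hdW (𝒦.pPart (w₀ * n₂ t)) ^ (2 * s.re + (n : ℝ))) :=
        mul_le_mul_of_nonneg_left (mul_rpow_le_rpow_mul_rpow hCy hM.le le_rfl) hC₀
    _ = C₀ * Cy ^ (2 * s.re + (n : ℝ)) * modDelta L e dV hdV dW hdW (𝒦.pPart (w₀ * n₂ t)) ^ (2 * s.re + (n : ℝ)) := by ring

/-! ## §4 Holomorphy of the unfolded inner section from the height letter -/

include hdV0 hdW0 in
/-- **`hJ ⇒ s ↦ c · ∫ f_s(w₀ · n₂ t · y) dμ` IS HOLOMORPHIC ON `{0 < re}`** for every `y`, `c` (★ (β0-hol) `differentiableOn_unfolded`; pointwise holomorphy = the family's;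
the majorant on `ball z (re z ∕ 2)` is `C₀ · C_y^{a₂} · (H^{a₁} + H^{a₂})`, `a₁ = re z + n`, `a₂ = 3 re z + n`).
[cite: MoeglinWaldspurger1995, II.1.7, IV.1.9] [cite: Conway1978, IV §2] [cite: KudlaRallis1994, §2 (2.10)–(2.12)] -/
theorem differentiableOn_corner_of_height (𝒦 : IwasawaDatum L e dV hdV dW hdW) {χ : HeckeCharacter L} (hχ : χ.IsUnitary)
    {f : ℂ → HA L e dV hdV dW hdW → ℂ} (hf : IsStandardSectionFamily 𝒦 χ f) (hcont : ∀ s : ℂ, Continuous (f s))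
    {T : Type*} [MeasurableSpace T] [TopologicalSpace T] [OpensMeasurableSpace T] (μ : Measure T)
    (w₀ : HA L e dV hdV dW hdW) (n₂ : T → HA L e dV hdV dW hdW) (hn₂ : Continuous n₂)
    (hJ : ∀ σ : ℝ, 0 < σ → Integrable (fun t => modDelta L e dV hdV dW hdW (𝒦.pPart (w₀ * n₂ t)) ^ (2 * σ + (n : ℝ))) μ)
    (y : HA L e dV hdV dW hdW) (c : ℂ) :
    DifferentiableOn ℂ (fun s => c * ∫ t, f s (w₀ * n₂ t * y) ∂μ) {s : ℂ | 0 < s.re} := by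
  obtain ⟨C₀, hC₀, hbd⟩ := exists_norm_le_height_rpow_of_standard L e dV hdV dW hdW 𝒦 hχ hf hcont
  obtain ⟨Cy, hCy, hy⟩ := exists_height_mul_le L e dV hdV hdV0 dW hdW hdW0 𝒦 y
  refine differentiableOn_unfolded μ f w₀ y n₂ c (fun s _ => ((hcont s).comp ((continuous_const.mul hn₂).mul continuous_const)).aestronglyMeasurable)
    (fun t => (hf.1.2 (w₀ * n₂ t * y)).differentiableOn) fun z hz => ?_
  have hz' : 0 < z.re := hz
  refine ⟨z.re / 2, by positivity, fun s hs => ?_, fun t => C₀ * Cy ^ (2 * (3 * z.re / 2) + (n : ℝ)) *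
      (modDelta L e dV hdV dW hdW (𝒦.pPart (w₀ * n₂ t)) ^ (2 * (z.re / 2) + (n : ℝ)) +
        modDelta L e dV hdV dW hdW (𝒦.pPart (w₀ * n₂ t)) ^ (2 * (3 * z.re / 2) + (n : ℝ))),
    ((hJ _ (by positivity)).add (hJ _ (by positivity))).const_mul _, fun t s hs => ?_⟩
  · -- `ball z (re z ∕ 2) ⊆ {0 < re}`
    have h1 : |s.re - z.re| < z.re / 2 := by
      have h2 : |(s - z).re| ≤ ‖s - z‖ := Complex.abs_re_le_norm (s - z)
      rw [Complex.sub_re] at h2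
      exact h2.trans_lt (mem_ball_iff_norm.1 hs)
    show 0 < s.re
    rcases abs_lt.1 h1 with ⟨h3, -⟩
    linarith
  · -- the bound on the ball
    have h1 : |s.re - z.re| < z.re / 2 := by
      have h2 : |(s - z).re| ≤ ‖s - z‖ := Complex.abs_re_le_norm (s - z)
      rw [Complex.sub_re] at h2
      exact h2.trans_lt (mem_ball_iff_norm.1 hs)
    obtain ⟨h3, h4⟩ := abs_lt.1 h1
    have ha₁ : 2 * (z.re / 2) + (n : ℝ) ≤ 2 * s.re + (n : ℝ) := by linarith
    have ha₂ : 2 * s.re + (n : ℝ) ≤ 2 * (3 * z.re / 2) + (n : ℝ) := by linarith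
    have ha : 0 ≤ 2 * s.re + (n : ℝ) := by nlinarith [Nat.cast_nonneg (α := ℝ) n]
    have hM := modDelta_pos L e dV hdV dW hdW (𝒦.pPart (w₀ * n₂ t))
    have hCya : 0 ≤ Cy ^ (2 * (3 * z.re / 2) + (n : ℝ)) := Real.rpow_nonneg (zero_le_one.trans hCy) _
    -- `x^a ≤ x^{a₁} + x^{a₂}` (`x ≤ 1`: the smaller exponent dominates; `1 ≤ x`: the larger one)
    have hsum : modDelta L e dV hdV dW hdW (𝒦.pPart (w₀ * n₂ t)) ^ (2 * s.re + (n : ℝ)) ≤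
        modDelta L e dV hdV dW hdW (𝒦.pPart (w₀ * n₂ t)) ^ (2 * (z.re / 2) + (n : ℝ)) + modDelta L e dV hdV dW hdW (𝒦.pPart (w₀ * n₂ t)) ^ (2 * (3 * z.re / 2) + (n : ℝ)) := by
      rcases le_total (modDelta L e dV hdV dW hdW (𝒦.pPart (w₀ * n₂ t))) 1 with hx1 | hx1
      · exact (Real.rpow_le_rpow_of_exponent_ge hM hx1 ha₁).trans (le_add_of_nonneg_right (Real.rpow_nonneg hM.le _))
      · exact (Real.rpow_le_rpow_of_exponent_le hx1 ha₂).trans (le_add_of_nonneg_left (Real.rpow_nonneg hM.le _))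
    calc ‖f s (w₀ * n₂ t * y)‖
        ≤ C₀ * modDelta L e dV hdV dW hdW (𝒦.pPart (w₀ * n₂ t * y)) ^ (2 * s.re + (n : ℝ)) := hbd s _
      _ ≤ C₀ * (Cy * modDelta L e dV hdV dW hdW (𝒦.pPart (w₀ * n₂ t))) ^ (2 * s.re + (n : ℝ)) :=
          mul_le_mul_of_nonneg_left (Real.rpow_le_rpow (modDelta_pos L e dV hdV dW hdW _).le (hy _) ha) hC₀
      _ ≤ C₀ * (Cy ^ (2 * (3 * z.re / 2) + (n : ℝ)) * modDelta L e dV hdV dW hdW (𝒦.pPart (w₀ * n₂ t)) ^ (2 * s.re + (n : ℝ))) :=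
          mul_le_mul_of_nonneg_left (mul_rpow_le_rpow_mul_rpow hCy hM.le ha₂) hC₀
      _ ≤ C₀ * (Cy ^ (2 * (3 * z.re / 2) + (n : ℝ)) * (modDelta L e dV hdV dW hdW (𝒦.pPart (w₀ * n₂ t)) ^ (2 * (z.re / 2) + (n : ℝ)) +
            modDelta L e dV hdV dW hdW (𝒦.pPart (w₀ * n₂ t)) ^ (2 * (3 * z.re / 2) + (n : ℝ)))) :=
          mul_le_mul_of_nonneg_left (mul_le_mul_of_nonneg_left hsum hCya) hC₀
      _ = _ := by ring

/-! ## §5 The two I4 letters at the datum of #41 (`n = 2`) -/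

section Datum

variable (e : Fin N × Fin M ≃ Fin 2)
variable [MeasurableSpace (unipDelta L e dV hdV dW hdW)] [BorelSpace (unipDelta L e dV hdV dW hdW)]

variable {g₀ : UnitaryGroup.rationalPair (Fp L) L (IsCMField.complexConj L) N M (Matrix.diagonal dV) (Matrix.diagonal dW)}
  (hg₀ : ((g₀ : GL (Fin N × Fin M) L) : Matrix (Fin N × Fin M) (Fin N × Fin M) L) = Matrix.diagonal (fun k => 1 - 2 * (![0, 1] : Fin 2 → L) (e k)))
  (Λ : GL (Fin 2) (AdeleRing (𝓞 L) L) →* HA L e dV hdV dW hdW)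
  (hΛ : ∀ g : GL (Fin 2) (AdeleRing (𝓞 L) L), blk L e dV hdV dW hdW (Λ g) =
    cayR (AdeleRing (𝓞 L) L) (Fin 2) * Matrix.fromBlocks (g : Matrix (Fin 2) (Fin 2) (AdeleRing (𝓞 L) L)) 0 0
      (((gramR L e dV hdV dW hdW).map ((algebraMap L (AdeleRing (𝓞 L) L)).comp (algebraMap (Fp L) L)))⁻¹ *
        (((g⁻¹ : GL (Fin 2) (AdeleRing (𝓞 L) L)) : Matrix (Fin 2) (Fin 2) (AdeleRing (𝓞 L) L)).map
          (conjAdele (Fp L) L (IsCMField.complexConj L)))ᵀ *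
        (gramR L e dV hdV dW hdW).map ((algebraMap L (AdeleRing (𝓞 L) L)).comp (algebraMap (Fp L) L))) *
      cayRinv (AdeleRing (𝓞 L) L) (Fin 2))
  (Γ₀ : Subgroup (unipDelta L e dV hdV dW hdW))
  (hΓ₀ : ∀ u : unipDelta L e dV hdV dW hdW, u ∈ Γ₀ ↔ (u : HA L e dV hdV dW hdW) ∈ ratH L e dV hdV dW hdW ∧
    IsSiegelDelta L e dV hdV dW hdW (iotaGG L e dV hdV dW hdW (1, UnitaryGroup.rationalPairToAdelic (Fp L) L (IsCMField.complexConj L) N M (Matrix.diagonal dV) (Matrix.diagonal dW) g₀) * (u : HA L e dV hdV dW hdW) * (iotaGG L e dV hdV dW hdW (1, UnitaryGroup.rationalPairToAdelic (Fp L) L (IsCMField.complexConj L) N M (Matrix.diagonal dV) (Matrix.diagonal dW) g₀))⁻¹))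

include hg₀ hΛ hΓ₀ hdV0 hdW0 in
/-- **(D1) THE TWO (β0-hol) LETTERS OF ★ I4 ED. 4 FROM THE CORNER-LINE HEIGHT LETTER.**  `n = 2`, the datum of #41 (★ α3-2's `hg₀ Λ hΛ Γ₀ hΓ₀`); `νN` Haar on `N_Δ(𝔸)`,
`β₁` a `Γ₀`-covering weight, `χ` unitary, `f` a STANDARD family for `𝒦` with continuous members, `F_s(x) = ∫ β₁(u) • f_s(w₀·(u·x)) dνN(u)` BY VALUE.  If for every corner
line `n₂` of ★ C-part `inner_section_unfold` (continuous, valued in `N_Δ(𝔸)`, `(blk n₂(t))₁₂ = t·i·E₁₁`) and every additive Haar measure `μ` of `𝔸_{L⁺}` the Iwasawa height is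
integrable along the line — `hJ : ∀ σ > 0, Integrable (t ↦ H_𝒦(w₀·n₂ t)^{2σ+2}) μ` — then
**`hint : ∀ s, 0 < re s → ∀ k ∈ 𝒦.K, Integrable (u ↦ (β₁ u).toReal • f_s(w₀·(u·k))) νN`** and **`hFhol : ∀ y, DifferentiableOn ℂ (s ↦ F_s y) {0 < re}`** — the binders
`hint`, `hFhol` of ★ `exists_middleTerm_package_of_standard` BYTE FOR BYTE (§3 + §4 + ★ C-part's transfer and unfolding, `μ := Measure.addHaar`, as ★ I4 ED. 4 §2).
[cite: MoeglinWaldspurger1995, II.1.7, IV.1.9] [cite: KudlaRallis1994, §2 (2.10)–(2.12)] [cite: Tan1999, §4 Prop. 4.8] [cite: Conway1978, IV §2] -/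
theorem hint_and_hFhol_of_cornerHeight
    (νN : Measure (unipDelta L e dV hdV dW hdW)) [νN.IsHaarMeasure] {β₁ : unipDelta L e dV hdV dW hdW → ℝ≥0∞} (hβ₁ : IsCoveringWeight Γ₀ β₁)
    {χ : HeckeCharacter L} (hχ : χ.IsUnitary) (𝒦 : IwasawaDatum L e dV hdV dW hdW)
    (f : ℂ → HA L e dV hdV dW hdW → ℂ) (hstd : IsStandardSectionFamily 𝒦 χ f) (hcont : ∀ s : ℂ, Continuous (f s))
    (F : ℂ → HA L e dV hdV dW hdW → ℂ)
    (hF : ∀ (s : ℂ) (x : HA L e dV hdV dW hdW), F s x = ∫ u, (β₁ u).toReal • f s (iotaGG L e dV hdV dW hdW (1, UnitaryGroup.rationalPairToAdelic (Fp L) L (IsCMField.complexConj L) N M (Matrix.diagonal dV) (Matrix.diagonal dW) g₀) * ((u : HA L e dV hdV dW hdW) * x)) ∂νN)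
    (hJ : ∀ (n₂ : AdeleRing (𝓞 (Fp L)) (Fp L) → HA L e dV hdV dW hdW), Continuous n₂ → (∀ t, n₂ t ∈ unipDelta L e dV hdV dW hdW) →
      (∀ t, (blk L e dV hdV dW hdW (n₂ t)).toBlocks₁₂ =
        Matrix.single (1 : Fin 2) (1 : Fin 2) (AdeleRing.baseChange (Fp L) L t * algebraMap L (AdeleRing (𝓞 L) L) (imagUnit L))) →
      ∀ σ : ℝ, 0 < σ → ∀ (mA : MeasurableSpace (AdeleRing (𝓞 (Fp L)) (Fp L))) (μ : Measure (AdeleRing (𝓞 (Fp L)) (Fp L))),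
        BorelSpace (AdeleRing (𝓞 (Fp L)) (Fp L)) → μ.IsAddHaarMeasure →
        Integrable (fun t => modDelta L e dV hdV dW hdW (𝒦.pPart
          (iotaGG L e dV hdV dW hdW (1, UnitaryGroup.rationalPairToAdelic (Fp L) L (IsCMField.complexConj L) N M (Matrix.diagonal dV) (Matrix.diagonal dW) g₀) * n₂ t)) ^
            (2 * σ + (2 : ℝ))) μ) :
    (∀ s : ℂ, 0 < s.re → ∀ k : HA L e dV hdV dW hdW, k ∈ 𝒦.K →
      Integrable (fun u : unipDelta L e dV hdV dW hdW => (β₁ u).toReal • f s (iotaGG L e dV hdV dW hdW (1, UnitaryGroup.rationalPairToAdelic (Fp L) L (IsCMField.complexConj L) N M (Matrix.diagonal dV) (Matrix.diagonal dW) g₀) * ((u : HA L e dV hdV dW hdW) * k))) νN) ∧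
    (∀ y : HA L e dV hdV dW hdW, DifferentiableOn ℂ (fun s => F s y) {s : ℂ | 0 < s.re}) := by
  -- the additive Haar measure of `𝔸_{L⁺}` over `borel` and the corner line (★ C-part), as in ★ I4 ED. 4 §2
  letI : MeasurableSpace (AdeleRing (𝓞 (Fp L)) (Fp L)) := borel _
  haveI : BorelSpace (AdeleRing (𝓞 (Fp L)) (Fp L)) := ⟨rfl⟩
  haveI := secondCountableTopology_adeleRing (Fp L)
  haveI := locallyCompactSpace_adeleRing' (Fp L)
  obtain ⟨n₂, Cu, -, -, hn₂c, -, hn₂mem, hn₂X, -, hunf⟩ :=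
    inner_section_unfold L e dV hdV dW hdW hg₀ Λ hΛ hdV0 hdW0 νN (Measure.addHaar : Measure (AdeleRing (𝓞 (Fp L)) (Fp L)))
  have hJ' : ∀ σ : ℝ, 0 < σ → Integrable (fun t => modDelta L e dV hdV dW hdW (𝒦.pPart
      (iotaGG L e dV hdV dW hdW (1, UnitaryGroup.rationalPairToAdelic (Fp L) L (IsCMField.complexConj L) N M (Matrix.diagonal dV) (Matrix.diagonal dW) g₀) * n₂ t)) ^
        (2 * σ + ((2 : ℕ) : ℝ))) (Measure.addHaar : Measure (AdeleRing (𝓞 (Fp L)) (Fp L))) := fun σ hσ => by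
    rw [Nat.cast_ofNat]
    exact hJ n₂ hn₂c hn₂mem hn₂X σ hσ _ _ inferInstance inferInstance
  refine ⟨fun s hs k _ => ?_, fun y => ?_⟩
  · -- `hint`: ★ C-part's transfer + §3
    exact ((hunf Γ₀ hΓ₀ β₁ hβ₁ χ s (f s) (hstd.1.1 s) (hcont s)).1 k).1.2
      (integrable_corner_of_height L e dV hdV hdV0 dW hdW hdW0 𝒦 hχ hstd hcont (Measure.addHaar : Measure (AdeleRing (𝓞 (Fp L)) (Fp L))) _ n₂ hn₂c
        (hJ' s.re hs) k hs rfl)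
  · -- `hFhol`: ★ C-part's unfolding + §4
    have hunfold : ∀ s : ℂ, F s y = ((Cu.toReal : ℝ) : ℂ) * ∫ t,
        f s (iotaGG L e dV hdV dW hdW (1, UnitaryGroup.rationalPairToAdelic (Fp L) L (IsCMField.complexConj L) N M (Matrix.diagonal dV) (Matrix.diagonal dW) g₀) *
          n₂ t * y) ∂(Measure.addHaar : Measure (AdeleRing (𝓞 (Fp L)) (Fp L))) :=
      fun s => (hunf Γ₀ hΓ₀ β₁ hβ₁ χ s (f s) (hstd.1.1 s) (hcont s)).2 (F s) (hF s) y
    refine (differentiableOn_corner_of_height L e dV hdV hdV0 dW hdW hdW0 𝒦 hχ hstd hcont (Measure.addHaar : Measure (AdeleRing (𝓞 (Fp L)) (Fp L))) _ n₂ hn₂c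
      hJ' y ((Cu.toReal : ℝ) : ℂ)).congr fun s _ => hunfold s

end Datum

end Summit.HodgeConjecture.HodgeConjecture.Cruxes.HLiu418.K2LiuSiegelMiddleTermCornerMajorant

end
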